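import Summits.QuantumAdvantage.QuantumAdvantage.Theorems.NearExactIsExact.Negative.TwistedTranslation

/-!
# `NearExactIsExact` (stmt-QuantumAdvantage-14043) — negative lemma THEOREM HP (gen 39):
  a skew translation seen only on a `t`-hyperplane never realises the flat residual

**Context (BQ-11 strata, DISPROOF.md §46.3, §47.10 of the b2b cell).** In the naff `= 5` normal form
of the last Maiorana–McFarland habitat of `NearExactIsExact` the biquadratic permutation is
`π(u,t) = (ū, g(ū) ⊕ u₆(1 ⊕ λ(ū)) ⊕ (Aū)·t, B(u) ⊕ M(u)·t)`; the sub-stratum `A = 0, M ≡ I` is THEOREM TT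
(`Negative.TwistedTranslation`). This file treats MIXING (`A ≠ 0`): if all the mixing sits in ONE
`t`-coordinate `i₀` (rank-one `A = α ⊗ e_{i₀}`, `λ = 0`, `g = 0`, `M ≡ I`), then on the hyperplane
`{t_{i₀} = 0}` the map is the plain skew translation `(u,t) ↦ (u, t ⊕ B(u))` — and that much of the
residual identity is already contradictory.

**What this file proves (all `r`, no computation).** `hyperplane_skew_residual_ne_flat`: for ANY index
`i₀`, ANY quadratic family `B_k : 𝔽₂⁶ → 𝔽₂` and ALL cubic `c₁, c₂` on `6 + r` bits, the identity
`c₁(u,w) ⊕ c₂(u, w ⊕ B(u)) = 1_{u = 0}` cannot hold for all `u` and all `w` WITH `w_{i₀} = 0`. So every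
`π` whose restriction to a `t`-hyperplane is a skew translation is excluded — in particular the frames
`M ≡ I, λ = 0, g = 0, A = α ⊗ e_{i₀}` of THEOREM TT-A (DISPROOF.md §47.10, where the generic engine found
the single parity row in every cell; this is its pen-and-paper form, PROPOSITION TT-A₀). THEOREM HP′
(`affine_section_skew_residual_ne_flat`) replaces the hyperplane by any affine section `{w_{i₀} = ℓ(u)}`,
which adds the frames `λ = α`, `g = α·m` (`m` affine) — mixing form dividing `g`.

**Proof (hyperplane pair identity / parity).** Expand `c₂(v,w) = Σ_{|S| ≤ 3} w_S C_S(v)`. The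
HYPERPLANE PAIR IDENTITY (`texp_split_hyperplane`): modulo `2`, a monomial `w_S C_S` with `|S| ≤ 3` is
counted exactly once by `[|S| ≤ 1 ∨ (|S| = 2 ∧ i₀ ∈ S)] + #{T ⊆ S ∖ i₀ : |T| = 2}` (the counts are
`1+0, 1+0, 1+0 | 0+1, 0+1, 0+3`), so
`c₂(v,ρ) = Σ_{|S| ≤ 1 ∨ (|S| = 2, i₀ ∈ S)} ρ_S C_S + Σ_{|T| = 2, i₀ ∉ T} ρ_T K_T` with the pair coefficients
`K_T = Σ_{S ⊇ T} ρ_{S∖T} C_S` of THEOREM TT — but only those AVOIDING `i₀`. For such `T` the points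
`w = 1_J`, `J ⊆ T`, lie on the hyperplane, so `K_T(u) = ⨁_J c₂(u, B(u) ⊕ 1_J) = ⨁_J c₁(u, 1_J)` is the
`t`-Möbius coefficient `coefC c₁ T`, affine (`tTcoef_eq`, `coefC_deg`). Every summand then has degree
`≤ 5` on the `6`-bit frame (`2|S| + (3 − |S|) ≤ 5` for `|S| ≤ 2`, `4 + 1` for the pairs), so
`u ↦ c₂(u, B u)` has EVEN weight (`coreHP`); but the zero section (`w = 0`, on the hyperplane) says it is
`c₁(u,0) ⊕ 1_{u=0}`, of ODD weight.

HONEST FRAMING: the value here is a THEOREM (a kernel-checked negative lemma closing an infinite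
sub-family — "mixing in one `t`-coordinate" — of the last Maiorana–McFarland habitat of
`NearExactIsExact`), NOT summit progress; the crux and the summit are untouched.
-/

set_option linter.dupNamespace false -- D-0017: single-problem summit ⇒ `QuantumAdvantage.QuantumAdvantage` by design

namespace Summit.QuantumAdvantage.QuantumAdvantage.Theorems.NearExactIsExact.Negative.HyperplaneSkew

open Finset
open Literature.Computability.QuantumComplexity
open Literature.Computability.QuantumComplexity.BuzetChailloux (bxor)
open Summit.QuantumAdvantage.QuantumAdvantage.Theorems.CubicForrelation.NearExactIsExact
  (fc_isDegLeFun_comp fc_deg_bxor te_isDegLeFun_band)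
open Summit.QuantumAdvantage.QuantumAdvantage.Theorems.NearExactIsExact.Negative.SkewProductCore
open Summit.QuantumAdvantage.QuantumAdvantage.Theorems.NearExactIsExact.Negative.SkewProductResidual
open Summit.QuantumAdvantage.QuantumAdvantage.Theorems.NearExactIsExact.Negative.TwistedTranslation

variable {r : ℕ}

/-! ### The hyperplane pair identity -/

/-- **Hyperplane pair identity.** For a fixed index `i₀`:
`texp C ρ = Σ_{|S| ≤ 1 ∨ (|S| = 2 ∧ i₀ ∈ S)} ρ_S C_S + Σ_{|T| = 2, i₀ ∉ T} ρ_T K_T` in `𝔽₂`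
(a monomial `ρ_S C_S`, `|S| ≤ 3`, is counted `[|S| ≤ 1 ∨ (|S| = 2 ∧ i₀ ∈ S)] + C(|S ∖ i₀|, 2) ≡ 1` times).
[folklore] -/
theorem texp_split_hyperplane (i₀ : Fin r) (ρ : Fin r → (Fin 6 → Bool) → Bool)
    (C : Finset (Fin r) → (Fin 6 → Bool) → Bool) (v : Fin 6 → Bool) :
    texp C (fun m => ρ m v) v =
      ∑ S ∈ (P3 r).filter (fun S => S.card ≤ 1 ∨ (S.card = 2 ∧ i₀ ∈ S)), (∏ m ∈ S, ind (ρ m v)) * ind (C S v) +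
      ∑ T ∈ ((univ : Finset (Fin r)).powersetCard 2).filter (fun T => i₀ ∉ T), (∏ m ∈ T, ind (ρ m v)) *
        (∑ S ∈ (P3 r).filter (fun S => T ⊆ S), (∏ m ∈ S \ T, ind (ρ m v)) * ind (C S v)) := by
  have hA : ∀ T : Finset (Fin r), (∏ m ∈ T, ind (ρ m v)) *
      (∑ S ∈ (P3 r).filter (fun S => T ⊆ S), (∏ m ∈ S \ T, ind (ρ m v)) * ind (C S v)) =
      ∑ S ∈ P3 r, if T ⊆ S then (∏ m ∈ S, ind (ρ m v)) * ind (C S v) else 0 := by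
    intro T
    rw [sum_filter, mul_sum]
    refine sum_congr rfl fun S _ => ?_
    split_ifs with hTS
    · rw [← mul_assoc, mul_comm (∏ m ∈ T, ind (ρ m v)), prod_sdiff hTS]
    · exact mul_zero _
  have hfilter : ∀ S : Finset (Fin r),
      (((univ : Finset (Fin r)).powersetCard 2).filter (fun T => i₀ ∉ T)).filter (fun T => T ⊆ S) =
        (S.erase i₀).powersetCard 2 := by
    intro S; ext T
    simp only [mem_filter, mem_powersetCard, subset_univ, true_and]
    constructor
    · rintro ⟨⟨hT2, hi⟩, hTS⟩
      exact ⟨fun m hm => mem_erase.mpr ⟨fun hmi => hi (hmi ▸ hm), hTS hm⟩, hT2⟩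
    · rintro ⟨hTS, hT2⟩
      exact ⟨⟨hT2, fun hi => (mem_erase.mp (hTS hi)).1 rfl⟩, fun m hm => (mem_erase.mp (hTS hm)).2⟩
  have hB : ∑ T ∈ ((univ : Finset (Fin r)).powersetCard 2).filter (fun T => i₀ ∉ T), (∏ m ∈ T, ind (ρ m v)) *
      (∑ S ∈ (P3 r).filter (fun S => T ⊆ S), (∏ m ∈ S \ T, ind (ρ m v)) * ind (C S v)) =
      ∑ S ∈ P3 r, (((S.erase i₀).card.choose 2 : ℕ) : ZMod 2) * ((∏ m ∈ S, ind (ρ m v)) * ind (C S v)) := by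
    rw [sum_congr rfl (fun T _ => hA T), sum_comm]
    refine sum_congr rfl fun S _ => ?_
    rw [← sum_filter, hfilter S, sum_const, card_powersetCard, nsmul_eq_mul]
  have c0 : Nat.choose 0 2 = 0 := by decide
  have c1 : Nat.choose 1 2 = 0 := by decide
  have c2 : Nat.choose 2 2 = 1 := by decide
  have c3 : Nat.choose 3 2 = 3 := by decide
  have c11 : Nat.choose (1 - 1) 2 = 0 := by decide
  have c21 : Nat.choose (2 - 1) 2 = 0 := by decide
  have c31 : Nat.choose (3 - 1) 2 = 1 := by decide
  have z3 : ((3 : ℕ) : ZMod 2) = 1 := by decide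
  have hC : ∀ S ∈ P3 r, (∏ m ∈ S, ind (ρ m v)) * ind (C S v) =
      (if (S.card ≤ 1 ∨ (S.card = 2 ∧ i₀ ∈ S)) then (∏ m ∈ S, ind (ρ m v)) * ind (C S v) else 0) +
        (((S.erase i₀).card.choose 2 : ℕ) : ZMod 2) * ((∏ m ∈ S, ind (ρ m v)) * ind (C S v)) := by
    intro S hS
    have h3 := mem_P3.mp hS
    by_cases hi : i₀ ∈ S
    · have hpos : 0 < S.card := card_pos.mpr ⟨i₀, hi⟩
      rw [card_erase_of_mem hi]
      rcases (by omega : S.card = 1 ∨ S.card = 2 ∨ S.card = 3) with h | h | h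
      · rw [h, c11, Nat.cast_zero, zero_mul, add_zero, if_pos (Or.inl (le_refl 1))]
      · rw [h, c21, Nat.cast_zero, zero_mul, add_zero, if_pos (Or.inr ⟨rfl, hi⟩)]
      · rw [h, c31, Nat.cast_one, one_mul, if_neg (by norm_num), zero_add]
    · rw [erase_eq_self.mpr hi]
      rcases (by omega : S.card = 0 ∨ S.card = 1 ∨ S.card = 2 ∨ S.card = 3) with h | h | h | h
      · rw [h, c0, Nat.cast_zero, zero_mul, add_zero, if_pos (Or.inl (by norm_num))]
      · rw [h, c1, Nat.cast_zero, zero_mul, add_zero, if_pos (Or.inl (le_refl 1))]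
      · rw [h, c2, Nat.cast_one, one_mul, if_neg (fun h' => h'.elim (by omega) (fun h'' => hi h''.2)), zero_add]
      · rw [h, c3, z3, one_mul, if_neg (by norm_num), zero_add]
  calc texp C (fun m => ρ m v) v = ∑ S ∈ P3 r, (∏ m ∈ S, ind (ρ m v)) * ind (C S v) := rfl
    _ = ∑ S ∈ P3 r, ((if (S.card ≤ 1 ∨ (S.card = 2 ∧ i₀ ∈ S)) then (∏ m ∈ S, ind (ρ m v)) * ind (C S v) else 0) +
          (((S.erase i₀).card.choose 2 : ℕ) : ZMod 2) * ((∏ m ∈ S, ind (ρ m v)) * ind (C S v))) := sum_congr rfl hC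
    _ = _ := by rw [sum_add_distrib, ← sum_filter, ← hB]

/-! ### The parity core -/

/-- **THEOREM HP, abstract core.** `ρ_k` quadratic, `deg C_S ≤ 5 − 2|S|` for `|S| ≤ 2`, and the pair
coefficients `K_T` AVOIDING `i₀` affine — all on the same `6`-bit frame. Then `v ↦ texp C (ρ v) v` has
even weight: every summand of the hyperplane pair identity has degree `≤ 5 < 6`. [folklore] -/
theorem coreHP (i₀ : Fin r) {ρ : Fin r → (Fin 6 → Bool) → Bool} (hρ : ∀ k, IsDegLeFun 2 (ρ k))
    {C : Finset (Fin r) → (Fin 6 → Bool) → Bool}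
    (hC : ∀ S : Finset (Fin r), S.card ≤ 2 → IsDegLeFun (5 - 2 * S.card) (C S))
    (hT : ∀ T : Finset (Fin r), T.card = 2 → i₀ ∉ T →
      IsDegLeFun 1 (fun v => decide ((∑ S ∈ (P3 r).filter (fun S => T ⊆ S), (∏ m ∈ S \ T, ind (ρ m v)) * ind (C S v)) = 1))) :
    ∑ v, texp C (fun m => ρ m v) v = 0 := by
  have hdeg : IsDegLeFun 5 (fun v => decide (texp C (fun m => ρ m v) v = 1)) := by
    have e : (fun v => decide (texp C (fun m => ρ m v) v = 1)) = fun v =>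
        (decide ((∑ S ∈ (P3 r).filter (fun S => S.card ≤ 1 ∨ (S.card = 2 ∧ i₀ ∈ S)), (∏ m ∈ S, ind (ρ m v)) * ind (C S v)) = 1) ^^
          decide ((∑ T ∈ ((univ : Finset (Fin r)).powersetCard 2).filter (fun T => i₀ ∉ T),
            (∏ m ∈ T, ind (ρ m v)) * (∑ S ∈ (P3 r).filter (fun S => T ⊆ S), (∏ m ∈ S \ T, ind (ρ m v)) * ind (C S v))) = 1)) := by
      funext v; rw [texp_split_hyperplane i₀, zmod2_decide_add]
    rw [e]
    refine fc_deg_bxor ?_ ?_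
    · refine isDegLeFun_sum (fun S v => (∏ m ∈ S, ind (ρ m v)) * ind (C S v)) _ (fun S hS => ?_)
      rw [mem_filter] at hS
      have hS2 : S.card ≤ 2 := by
        rcases hS.2 with h | ⟨h, _⟩ <;> omega
      have e1 : (fun v => decide ((∏ m ∈ S, ind (ρ m v)) * ind (C S v) = 1)) =
          fun v => (decide ((∏ m ∈ S, ind (ρ m v)) = 1) && C S v) := by
        funext v; rw [zmod2_decide_mul, decide_ind_eq_one]
      rw [e1]
      exact (te_isDegLeFun_band (isDegLeFun_prod (fun m => ρ m) S (fun m _ => hρ m)) (hC S hS2)).mono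
        (by omega)
    · refine isDegLeFun_sum (fun T v => (∏ m ∈ T, ind (ρ m v)) *
        (∑ S ∈ (P3 r).filter (fun S => T ⊆ S), (∏ m ∈ S \ T, ind (ρ m v)) * ind (C S v))) _ (fun T hT2 => ?_)
      rw [mem_filter] at hT2
      have h2 : T.card = 2 := (mem_powersetCard.mp hT2.1).2
      have e1 : (fun v => decide ((∏ m ∈ T, ind (ρ m v)) *
          (∑ S ∈ (P3 r).filter (fun S => T ⊆ S), (∏ m ∈ S \ T, ind (ρ m v)) * ind (C S v)) = 1)) =
          fun v => (decide ((∏ m ∈ T, ind (ρ m v)) = 1) &&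
            decide ((∑ S ∈ (P3 r).filter (fun S => T ⊆ S), (∏ m ∈ S \ T, ind (ρ m v)) * ind (C S v)) = 1)) := by
        funext v; rw [zmod2_decide_mul]
      rw [e1]
      exact (te_isDegLeFun_band (isDegLeFun_prod (fun m => ρ m) T (fun m _ => hρ m)) (hT T h2 hT2.2)).mono
        (by omega)
  have h0 := sum_ind_eq_zero_of_deg_five hdeg
  simpa only [ind_decide_eq_one] using h0

/-! ### THEOREM HP -/

/-- **THEOREM HP (gen 39).** `i₀ : Fin r` any index, `B_k : 𝔽₂⁶ → 𝔽₂` quadratic, `c₁, c₂` cubic on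
`6 + r` bits. Then the residual identity of the skew translation `(u,w) ↦ (u, w ⊕ B u)` cannot hold on
the whole hyperplane `{w_{i₀} = 0}` with right-hand side `1_{u = 0}` — for every `r`; nothing at all
is assumed off the hyperplane. Kills the sub-stratum {`naff = 5`, `M ≡ I`, `λ = 0`, `g = 0`,
`A = α ⊗ e_{i₀}`} of BQ-11 (DISPROOF.md §47.10, PROPOSITION TT-A₀). [folklore] -/
theorem hyperplane_skew_residual_ne_flat (i₀ : Fin r)
    (B : Fin r → (Fin 6 → Bool) → Bool) (hB : ∀ k, IsDegLeFun 2 (B k))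
    (c₁ c₂ : (Fin (6 + r) → Bool) → Bool) (h₁ : IsDegLeFun 3 c₁) (h₂ : IsDegLeFun 3 c₂) :
    ¬ ∀ (u : Fin 6 → Bool) (w : Fin r → Bool), w i₀ = false →
      (c₁ (Fin.append u w) ^^ c₂ (Fin.append u (fun k => w k ^^ B k u))) =
        decide (∀ i, u i = false) := by
  intro h
  have hx : ∀ (u : Fin 6 → Bool) (w : Fin r → Bool), w i₀ = false →
      c₂ (Fin.append u (fun k => w k ^^ B k u)) =
        (c₁ (Fin.append u w) ^^ decide (∀ i, u i = false)) :=
    fun u w hw => bool_solve _ _ _ (h u w hw)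
  -- (T) the pair coefficients avoiding `i₀` are `t`-Möbius coefficients of `c₁`, hence affine
  have hT : ∀ T : Finset (Fin r), T.card = 2 → i₀ ∉ T →
      IsDegLeFun 1 (fun u => decide ((∑ S ∈ (P3 r).filter (fun S => T ⊆ S),
        (∏ m ∈ S \ T, ind (B m u)) * ind (coefC c₂ S u)) = 1)) := by
    intro T hT2 hi
    have h40 : ((2 ^ 2 : ℕ) : ZMod 2) = 0 := by decide
    have e : (fun u => decide ((∑ S ∈ (P3 r).filter (fun S => T ⊆ S),
        (∏ m ∈ S \ T, ind (B m u)) * ind (coefC c₂ S u)) = 1)) = coefC c₁ T := by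
      funext u
      rw [tTcoef_eq B (coefC c₂) T u]
      have hJ : ∀ J ∈ T.powerset, texp (coefC c₂) (fun m => decide (m ∈ J) ^^ B m u) u =
          ind (c₁ (bxor (emb r u) (L J))) + ind (decide (∀ i, u i = false)) := by
        intro J hJ
        have hJi : indic J i₀ = false := by
          have hi' : i₀ ∉ J := fun hm => hi (mem_powerset.mp hJ hm)
          simp [indic, hi']
        rw [← expand c₂ h₂, emb_bxor_L, ← ind_xor, ← hx u (indic J) hJi]
        rfl
      rw [sum_congr rfl hJ, sum_add_distrib, sum_const, card_powerset, hT2, nsmul_eq_mul, h40,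
        zero_mul, add_zero]
      rfl
    rw [e]
    simpa [hT2] using coefC_deg c₁ h₁ T
  -- (S) `deg C_S ≤ 3 − |S| ≤ 5 − 2|S|` for `|S| ≤ 2`
  have hC : ∀ S : Finset (Fin r), S.card ≤ 2 → IsDegLeFun (5 - 2 * S.card) (coefC c₂ S) :=
    fun S hS => (coefC_deg c₂ h₂ S).mono (by omega)
  -- parity: even weight by the core ...
  have hcore := coreHP i₀ (C := coefC c₂) hB hC hT
  have hsum1 : ∑ u, ind (c₂ (Fin.append u (fun k => B k u))) = 0 := by
    rw [← hcore]
    exact sum_congr rfl fun u _ => expand c₂ h₂ u _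
  -- ... but the zero section (on the hyperplane) `u ↦ c₂(u, B u) = c₁(u,0) ⊕ 1_{u=0}` has odd weight
  have h0 : ∀ u : Fin 6 → Bool,
      c₂ (Fin.append u (fun k => B k u)) = (c₁ (emb r u) ^^ decide (∀ i, u i = false)) := by
    intro u
    have h' := hx u (fun _ => false) rfl
    simp only [Bool.false_xor] at h'
    exact h'
  have hc₁ : ∑ u, ind (c₁ (emb r u)) = 0 :=
    sum_ind_eq_zero_of_deg_five (fc_isDegLeFun_comp h₁ (emb r) (emb_coord_deg r) (by norm_num))
  have hδ : ∑ u : Fin 6 → Bool, ind (decide (∀ i, u i = false)) = 1 := by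
    rw [Finset.sum_eq_single (fun _ => false)]
    · simp
    · intro u _ hu
      have hu' : ¬ ∀ i, u i = false := fun h' => hu (funext h')
      simp [hu']
    · intro h'
      exact absurd (mem_univ _) h'
  have hsum2 : ∑ u, ind (c₂ (Fin.append u (fun k => B k u))) = 1 := by
    simp_rw [h0, ind_xor]
    rw [sum_add_distrib, hc₁, hδ, zero_add]
  exact zero_ne_one (hsum1.symm.trans hsum2)

/-! ### THEOREM HP′: affine sections -/

/-- The coordinates of the affine change of `t`-coordinates `(u, w) ↦ (u, w ⊕ ℓ(u)·e_{i₀})` are affine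
when `ℓ` is. [folklore] -/
theorem tshift_coord_deg (i₀ : Fin r) {ℓ : (Fin 6 → Bool) → Bool} (hℓ : IsDegLeFun 1 ℓ) :
    ∀ j : Fin (6 + r), IsDegLeFun 1 (fun x : Fin (6 + r) → Bool =>
      (Fin.append (uPart x) (fun k => tPart x k ^^ (decide (k = i₀) && ℓ (uPart x))) :
        Fin (6 + r) → Bool) j) := by
  intro j
  induction j using Fin.addCases with
  | left i =>
    have e : (fun x : Fin (6 + r) → Bool =>
        (Fin.append (uPart x) (fun k => tPart x k ^^ (decide (k = i₀) && ℓ (uPart x))) :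
          Fin (6 + r) → Bool) (Fin.castAdd r i)) = fun x => x (Fin.castAdd r i) :=
      funext fun x => Fin.append_left _ _ i
    rw [e]
    exact isDegLeFun_apply _ le_rfl
  | right k =>
    have e : (fun x : Fin (6 + r) → Bool =>
        (Fin.append (uPart x) (fun k => tPart x k ^^ (decide (k = i₀) && ℓ (uPart x))) :
          Fin (6 + r) → Bool) (Fin.natAdd 6 k)) =
        fun x => (x (Fin.natAdd 6 k) ^^ (decide (k = i₀) && ℓ (uPart x))) :=
      funext fun x => Fin.append_right _ _ k
    rw [e]
    have hℓ' : IsDegLeFun 1 (fun x : Fin (6 + r) → Bool => ℓ (uPart x)) :=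
      fc_isDegLeFun_comp hℓ uPart (fun i => isDegLeFun_apply _ le_rfl) (le_of_eq (one_mul 1))
    exact fc_deg_bxor (isDegLeFun_apply _ le_rfl)
      ((te_isDegLeFun_band (isDegLeFun_const 0 (decide (k = i₀))) hℓ').mono (by norm_num))

/-- **THEOREM HP′ (gen 39): affine sections.** `ℓ : 𝔽₂⁶ → 𝔽₂` affine; the skew-translation residual
identity cannot hold on the affine section `{w_{i₀} = ℓ(u)}` either (reduce to THEOREM HP by the affine
change of `t`-coordinates `w ↦ w ⊕ ℓ(u) e_{i₀}`, which keeps `B` quadratic and `c₁` cubic). In the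
naff `= 5` normal form this kills every frame `M ≡ I`, `A = α ⊗ e_{i₀}`, `λ = εα`, `g = α·m` with
`ε ∈ 𝔽₂` and `m` affine (take `ℓ = m ⊕ ε u₆`): rank-one mixing in one `t`-coordinate with `λ ∈ {0, α}`
and `g` divisible by the mixing form. [folklore] -/
theorem affine_section_skew_residual_ne_flat (i₀ : Fin r) (ℓ : (Fin 6 → Bool) → Bool)
    (hℓ : IsDegLeFun 1 ℓ) (B : Fin r → (Fin 6 → Bool) → Bool) (hB : ∀ k, IsDegLeFun 2 (B k))
    (c₁ c₂ : (Fin (6 + r) → Bool) → Bool) (h₁ : IsDegLeFun 3 c₁) (h₂ : IsDegLeFun 3 c₂) :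
    ¬ ∀ (u : Fin 6 → Bool) (w : Fin r → Bool), w i₀ = ℓ u →
      (c₁ (Fin.append u w) ^^ c₂ (Fin.append u (fun k => w k ^^ B k u))) =
        decide (∀ i, u i = false) := by
  intro h
  have hB' : ∀ k, IsDegLeFun 2 (fun u => (B k u ^^ (decide (k = i₀) && ℓ u))) := fun k =>
    fc_deg_bxor (hB k) ((te_isDegLeFun_band (isDegLeFun_const 0 (decide (k = i₀))) hℓ).mono (by norm_num))
  have hu : ∀ (u : Fin 6 → Bool) (w : Fin r → Bool), uPart (Fin.append u w) = u :=
    fun u w => funext fun i => Fin.append_left u w i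
  have ht : ∀ (u : Fin 6 → Bool) (w : Fin r → Bool), tPart (Fin.append u w) = w :=
    fun u w => funext fun k => Fin.append_right u w k
  have h₁' : IsDegLeFun 3 (fun x : Fin (6 + r) → Bool =>
      c₁ (Fin.append (uPart x) (fun k => tPart x k ^^ (decide (k = i₀) && ℓ (uPart x))))) :=
    fc_isDegLeFun_comp h₁ _ (tshift_coord_deg i₀ hℓ) (le_of_eq (one_mul 3))
  refine hyperplane_skew_residual_ne_flat i₀ (fun k u => (B k u ^^ (decide (k = i₀) && ℓ u))) hB'
    _ c₂ h₁' h₂ (fun u w hw => ?_)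
  have hw' : (fun k => w k ^^ (decide (k = i₀) && ℓ u)) i₀ = ℓ u := by simp [hw]
  have key := h u (fun k => w k ^^ (decide (k = i₀) && ℓ u)) hw'
  have e : (fun k => ((w k ^^ (decide (k = i₀) && ℓ u)) ^^ B k u)) =
      fun k => (w k ^^ (B k u ^^ (decide (k = i₀) && ℓ u))) := by
    funext k; rw [Bool.xor_assoc, Bool.xor_comm (decide (k = i₀) && ℓ u) (B k u)]
  rw [e] at key
  simpa only [hu, ht] using key

end Summit.QuantumAdvantage.QuantumAdvantage.Theorems.NearExactIsExact.Negative.HyperplaneSkew
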